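import Mathlib
import Literature.NumberTheory.Sieve.Maynard2016GPYWeights
import Literature.NumberTheory.Sieve.Maynard2016GPYMeasuresProof
import HarnessLib

/-!
# Maynard 2016, Lemma 8: the `G`-part PROVED, the `F`-part isolated as the named fact `Lemma8F`

Topic `Literature/NumberTheory/Sieve`. J. Maynard, *Large gaps between primes*, Ann. of Math. (2)
183 (2016), 915–933 = arXiv:1408.5110, §8, Lemma 8 (p. 13) and its proof:

> "We choose `G(t)` to be a smooth approximation to `1 − t` supported on `t ∈ [0, 1]` such that
> `J_k^{(2)}(G)/I_k^{(2)}(G) ≥ 1 − ε`. [...] By [Maynard 2015], we have that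
> `J_k^{(1)}(F_k)/I_k^{(1)}(F_k) ≫ (log k)/k`. We choose `F_{ℓ,j}` such that `F` is a smooth
> approximation to `F_k(10 t_1, …, 10 t_k)` [...]"

The typed `Lemma8` (`Maynard2016GPYWeights`) asks for smooth data `(J, c_j, F_{ℓ,j}, G)` with
`(Σ_i J^{(1),i}(F)) J^{(2)}(G) ≥ c (log k) I^{(1)}(F) I^{(2)}(G)`. Since
`J^{(2)}(G) = G(0)² P^{k−1}` and `I^{(2)}(G) = P^k` with `P = ∫_0^∞ G'(u)² du`, the `G`-part of
the lemma only asks for ONE fixed smooth non-negative `G` supported on `[0, 1]` with `G(0) ≠ 0`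
and `0 < P < ∞` — any such `G` will do, the ratio `G(0)²/P` being absorbed into the constant `c`
(Maynard's `1 − ε` optimisation is not needed). This file

* fixes `G = gFun`, `gFun u = expNegInvGlue (1 − u)` (`= e^{−1/(1−u)}` for `u < 1`, `0` for
  `u ≥ 1`), proves it is admissible (`C^∞`, `≥ 0`, `gFun 0 = e^{−1} ≠ 0`, vanishes on `(1, ∞)`)
  and that `0 < P` (`gInt_pos`: by the mean value theorem `G'` takes the value `−e^{−1}` in
  `(0, 1)`, and `G'` is continuous), with `I^{(2)} = P^k`, `J^{(2)} = gFun(0)² P^{k−1}`;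
* types the `F`-part as the named fact `Lemma8F` (data `(J, c_j, F_{ℓ,j})` only:
  `Σ_i J^{(1),i}(F) ≥ c (log k) I^{(1)}(F)`, `I^{(1)}(F) > 0`) — this is exactly
  "[Maynard 2015] + smooth approximation" of the source, i.e. the tree's PROVED
  `exists_maynardFunctional_gt_holds` (`MaynardTaoLargeKProofs`: `(Σ_m J_k^{(m)})/I_k > log k −
  2 log log k − 2` for `F_k = 1_{R_k} ∏ g(k t_i)`) transported to the smooth product-sum class (5.5)
  by the `L²`-density step quoted above (not proved here);
* PROVES `lemma8_of_lemma8F : Lemma8F → Lemma8`.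

Consequently (with `gpyMeasures_of_lemma7_lemma8`, `Maynard2016GPYMeasuresProof`) Maynard's
Theorem 1 follows from the two named facts `Lemma7` and `Lemma8F`:
`theorem1_of_lemma7_lemma8F`, `forall_rankinConstant_of_lemma7_lemma8F`.

## References

* J. Maynard, *Large gaps between primes*, Ann. of Math. (2) 183 (2016), 915–933; arXiv:1408.5110,
  Lemma 8 and its proof (p. 13). [Maynard2016LargeGaps]
* J. Maynard, *Small gaps between primes*, Ann. of Math. (2) 181 (2015), 383–413, Prop. 4.3 / §7
  (the function `F_k`). [Maynard2015]
-/

open Filter Finset MeasureTheory Set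
open scoped Topology ContDiff

namespace Literature.NumberTheory.Sieve

namespace Maynard2016

/-! ### The `F`-part of the data and the named fact `Lemma8F` -/

/-- The `F`-part of the smooth data of §5, displays (5.3)–(5.4) (the fields of `IsSieveData`
not involving `G`): `c_j > 0`; `F_{ℓ,j}` smooth, non-negative, not identically zero on `[0, ∞)`,
with `sup{Σ_ℓ u_ℓ : F_{ℓ,j}(u_ℓ) ≠ 0 ∀ ℓ} ≤ 1/10`. [cite: Maynard2016LargeGaps, §5 displays (5.3)–(5.4)] -/
structure IsSieveDataF (k J : ℕ) (c : Fin J → ℝ) (Fd : Fin k → Fin J → ℝ → ℝ) : Prop where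
  /-- `c_j > 0`. -/
  c_pos : ∀ j, 0 < c j
  /-- each `F_{ℓ,j}` is smooth. -/
  Fd_smooth : ∀ ℓ j, ContDiff ℝ ∞ (Fd ℓ j)
  /-- each `F_{ℓ,j}` is non-negative. -/
  Fd_nonneg : ∀ ℓ j u, 0 ≤ Fd ℓ j u
  /-- each `F_{ℓ,j}` is not identically zero on `[0, ∞)`. -/
  Fd_ne_zero : ∀ ℓ j, ∃ u, 0 ≤ u ∧ Fd ℓ j u ≠ 0
  /-- display (5.4): `sup{Σ_ℓ u_ℓ : F_{ℓ,j}(u_ℓ) ≠ 0 ∀ ℓ} ≤ 1/10`. -/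
  Fd_support : ∀ j (u : Fin k → ℝ), (∀ ℓ, 0 ≤ u ℓ) → (∀ ℓ, Fd ℓ j (u ℓ) ≠ 0) →
    ∑ ℓ, u ℓ ≤ 1 / 10

/-- **Maynard 2016, Lemma 8, `F`-part** ("By [Maynard 2015], `J_k^{(1)}(F_k)/I_k^{(1)}(F_k) ≫
(log k)/k`. We choose `F_{ℓ,j}` such that `F` is a smooth approximation to `F_k(10 t)` [...] with
`J^{(1)}(F)/I^{(1)}(F) ≥ (1/10 − ε) J^{(1)}(F_k)/I^{(1)}(F_k)`"): there are `c > 0` and `k₀` such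
that for every `k ≥ k₀` some `F`-data in the class (5.5) has `I^{(1)}(F) > 0` and
`Σ_i J^{(1),i}(F) ≥ c (log k) I^{(1)}(F)`. Named fact, not proved here (= the tree's proved
`exists_maynardFunctional_gt_holds` plus the `L²`-density of non-negative combinations of
products of smooth compactly supported functions). [cite: Maynard2016LargeGaps, Lemma 8 (proof, F-part)] -/
def Lemma8F : Prop :=
  ∃ c : ℝ, 0 < c ∧ ∃ k₀ : ℕ, ∀ k : ℕ, k₀ ≤ k →
    ∃ (J : ℕ) (cj : Fin J → ℝ) (Fd : Fin k → Fin J → ℝ → ℝ),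
      IsSieveDataF k J cj Fd ∧ 0 < I1 cj Fd ∧ c * Real.log k * I1 cj Fd ≤ ∑ i, J1 cj Fd i

/-! ### The fixed function `G` -/

/-- `G(u) = e^{−1/(1−u)}` for `u < 1`, `G(u) = 0` for `u ≥ 1`: a smooth non-negative function on
`ℝ`, supported on `(−∞, 1]`, with `G(0) = e^{−1} ≠ 0` (our stand-in for Maynard's "smooth
approximation to `1 − t` supported on `[0, 1]`"). [cite: Maynard2016LargeGaps, Lemma 8 (proof, choice of G)] -/
noncomputable def gFun (u : ℝ) : ℝ := expNegInvGlue (1 - u)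

/-- `G` is smooth. [cite: Maynard2016LargeGaps, Lemma 8 (proof, choice of G)] -/
theorem gFun_contDiff : ContDiff ℝ ∞ gFun :=
  expNegInvGlue.contDiff.comp (contDiff_const.sub contDiff_id)

/-- `G ≥ 0`. [cite: Maynard2016LargeGaps, Lemma 8 (proof, choice of G)] -/
theorem gFun_nonneg (u : ℝ) : 0 ≤ gFun u := expNegInvGlue.nonneg _

/-- `G(0) > 0`. [cite: Maynard2016LargeGaps, Lemma 8 (proof, choice of G)] -/
theorem gFun_zero_pos : 0 < gFun 0 := expNegInvGlue.pos_of_pos (by norm_num)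

/-- `G(u) = 0` for `u ≥ 1`. [cite: Maynard2016LargeGaps, Lemma 8 (proof, choice of G)] -/
theorem gFun_eq_zero {u : ℝ} (hu : 1 ≤ u) : gFun u = 0 :=
  expNegInvGlue.zero_of_nonpos (by linarith)

/-- Any `F`-data together with `G = gFun` is a full set of sieve data. [cite: Maynard2016LargeGaps, §5 displays (5.3)–(5.4)] -/
theorem isSieveData_gFun {k J : ℕ} {c : Fin J → ℝ} {Fd : Fin k → Fin J → ℝ → ℝ}
    (h : IsSieveDataF k J c Fd) : IsSieveData k J c Fd gFun where
  c_pos := h.c_pos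
  Fd_smooth := h.Fd_smooth
  Fd_nonneg := h.Fd_nonneg
  Fd_ne_zero := h.Fd_ne_zero
  Fd_support := h.Fd_support
  G_smooth := gFun_contDiff
  G_nonneg := gFun_nonneg
  G_ne_zero := ⟨0, le_rfl, gFun_zero_pos.ne'⟩
  G_support := fun _ hu => gFun_eq_zero hu.le

/-- `P = ∫_0^∞ G'(u)² du`. [cite: Maynard2016LargeGaps, Lemma 6 (definition of I^(2))] -/
noncomputable def gInt : ℝ := ∫ u in Set.Ioi (0 : ℝ), deriv gFun u ^ 2

/-- `G' = 0` on `(1, ∞)`. [cite: Maynard2016LargeGaps, Lemma 8 (proof, choice of G)] -/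
theorem deriv_gFun_eq_zero {u : ℝ} (hu : 1 < u) : deriv gFun u = 0 := by
  have h : gFun =ᶠ[𝓝 u] fun _ => (0 : ℝ) := by
    filter_upwards [eventually_gt_nhds hu] with v hv
    exact gFun_eq_zero hv.le
  rw [h.deriv_eq]
  exact deriv_const u 0

/-- `G'²` is integrable on `(0, ∞)` (continuous, vanishing on `(1, ∞)`). [cite: Maynard2016LargeGaps, Lemma 8 (proof, choice of G)] -/
theorem integrableOn_deriv_gFun_sq : IntegrableOn (fun u => deriv gFun u ^ 2) (Set.Ioi 0) := by
  have hc : Continuous fun u => deriv gFun u ^ 2 :=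
    (gFun_contDiff.continuous_deriv (by simp)).pow 2
  rw [← Set.Ioc_union_Ioi_eq_Ioi (zero_le_one : (0 : ℝ) ≤ 1)]
  refine (hc.integrableOn_Ioc).union ?_
  refine IntegrableOn.congr_fun (integrableOn_zero) (fun _ hu => ?_) measurableSet_Ioi
  simp [deriv_gFun_eq_zero (Set.mem_Ioi.1 hu)]

/-- `0 < P = ∫_0^∞ G'(u)² du`: `G'` is continuous and, by the mean value theorem, takes the value
`G(1) − G(0) = −e^{−1} ≠ 0` somewhere in `(0, 1)`. [cite: Maynard2016LargeGaps, Lemma 8 (proof, choice of G)] -/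
theorem gInt_pos : 0 < gInt := by
  have hd : Differentiable ℝ gFun := gFun_contDiff.differentiable (by simp)
  have hc : Continuous (deriv gFun) := gFun_contDiff.continuous_deriv (by simp)
  obtain ⟨u₀, hu₀, hu₀d⟩ := exists_deriv_eq_slope gFun (zero_lt_one' ℝ)
    hd.continuous.continuousOn (hd.differentiableOn.mono Set.Ioo_subset_Icc_self)
  rw [gFun_eq_zero le_rfl, sub_zero, div_one, zero_sub] at hu₀d
  -- `G'(u)² > G(0)²/4` near `u₀`
  have hlt : ∀ᶠ u in 𝓝 u₀, deriv gFun u < -(gFun 0 / 2) :=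
    hc.continuousAt.eventually_lt continuousAt_const (by rw [hu₀d]; linarith [gFun_zero_pos])
  obtain ⟨δ, hδ, hball⟩ := Metric.eventually_nhds_iff.1 hlt
  set δ' := min δ u₀ with hδ'
  have hδ'0 : 0 < δ' := lt_min hδ hu₀.1
  have hsub : Set.Ioo u₀ (u₀ + δ') ⊆ Set.Ioi 0 := fun u hu => by
    simp only [Set.mem_Ioo, Set.mem_Ioi] at hu ⊢; linarith [hu₀.1]
  have hlow : ∀ u ∈ Set.Ioo u₀ (u₀ + δ'), (gFun 0 / 2) ^ 2 ≤ deriv gFun u ^ 2 := by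
    intro u hu
    have h1 : dist u u₀ < δ := by
      rw [Real.dist_eq, abs_lt]
      simp only [Set.mem_Ioo] at hu
      constructor <;> linarith [min_le_left δ u₀]
    have h2 := hball h1
    have h3 : 0 < gFun 0 / 2 := by linarith [gFun_zero_pos]
    nlinarith
  have h1 : (gFun 0 / 2) ^ 2 * (volume.real (Set.Ioo u₀ (u₀ + δ'))) ≤
      ∫ u in Set.Ioo u₀ (u₀ + δ'), deriv gFun u ^ 2 :=
    setIntegral_ge_of_const_le_real measurableSet_Ioo (by simp) hlow
      (integrableOn_deriv_gFun_sq.mono_set hsub)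
  have h2 : ∫ u in Set.Ioo u₀ (u₀ + δ'), deriv gFun u ^ 2 ≤ gInt :=
    setIntegral_mono_set integrableOn_deriv_gFun_sq
      (Eventually.of_forall fun u => sq_nonneg _) (Eventually.of_forall hsub)
  have h3 : volume.real (Set.Ioo u₀ (u₀ + δ')) = δ' := by
    rw [Measure.real, Real.volume_Ioo, ENNReal.toReal_ofReal (by linarith)]; ring
  have h4 : 0 < (gFun 0 / 2) ^ 2 * δ' := by
    have := gFun_zero_pos; positivity
  rw [h3] at h1
  linarith

/-- `I^{(2)}(G) = P^k`. [cite: Maynard2016LargeGaps, Lemma 6 (definition of I^(2))] -/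
theorem I2_gFun (k : ℕ) : I2 k gFun = gInt ^ k := rfl

/-- `J^{(2)}(G) = G(0)² P^{k−1}`. [cite: Maynard2016LargeGaps, Lemma 7 (definition of J^(2))] -/
theorem J2_gFun (k : ℕ) : J2 k gFun = gFun 0 ^ 2 * gInt ^ (k - 1) := rfl

/-! ### Lemma 8 from its `F`-part -/

/-- **Maynard 2016, Lemma 8 from its `F`-part, PROVED**: with `G = gFun` one has
`(Σ J^{(1)}) J^{(2)} ≥ c (log k) I^{(1)} · G(0)² P^{k−1} = (c G(0)²/P) (log k) I^{(1)} I^{(2)}`.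
[cite: Maynard2016LargeGaps, Lemma 8] -/
theorem lemma8_of_lemma8F (h : Lemma8F) : Lemma8 := by
  obtain ⟨c, hc, k₀, hk₀⟩ := h
  have hP := gInt_pos
  have hG0 := gFun_zero_pos
  refine ⟨c * gFun 0 ^ 2 / gInt, by positivity, max k₀ 1, fun k hk => ?_⟩
  obtain ⟨J, cj, Fd, hF, hI1, hJ⟩ := hk₀ k ((le_max_left _ _).trans hk)
  have hk1 : 1 ≤ k := (le_max_right _ _).trans hk
  refine ⟨J, cj, Fd, gFun, isSieveData_gFun hF, hI1, by rw [I2_gFun]; positivity, ?_⟩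
  rw [I2_gFun, J2_gFun]
  have hpow : gInt ^ k = gInt * gInt ^ (k - 1) := by
    rw [← pow_succ']; congr 1; omega
  rw [hpow]
  have h1 : 0 ≤ gFun 0 ^ 2 * gInt ^ (k - 1) := by positivity
  have h2 := mul_le_mul_of_nonneg_right hJ h1
  have h3 : c * gFun 0 ^ 2 / gInt * Real.log k * (I1 cj Fd * (gInt * gInt ^ (k - 1))) =
      c * Real.log k * I1 cj Fd * (gFun 0 ^ 2 * gInt ^ (k - 1)) := by
    field_simp
  linarith

/-- `GPYMeasures` from `Lemma7` and the `F`-part of Lemma 8. [cite: Maynard2016LargeGaps, §8 (final paragraph)] -/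
theorem gpyMeasures_of_lemma7_lemma8F (h7 : Lemma7) (h8 : Lemma8F) : GPYMeasures :=
  gpyMeasures_of_lemma7_lemma8 h7 (lemma8_of_lemma8F h8)

/-- **Maynard's Theorem 1 from `Lemma7` and `Lemma8F`.** [cite: Maynard2016LargeGaps, Theorem 1] -/
theorem theorem1_of_lemma7_lemma8F (h7 : Lemma7) (h8 : Lemma8F) :
    Literature.NumberTheory.Sieve.Maynard2016_theorem1 :=
  theorem1_of_lemma7_lemma8 h7 (lemma8_of_lemma8F h8)

/-- **`∀ c, RankinConstant c` from `Lemma7` and `Lemma8F`.** [cite: Maynard2016LargeGaps, Theorem 1] -/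
theorem forall_rankinConstant_of_lemma7_lemma8F (h7 : Lemma7) (h8 : Lemma8F) (c : ℝ) :
    Literature.NumberTheory.Sieve.RankinConstant c :=
  forall_rankinConstant_of_lemma7_lemma8 h7 (lemma8_of_lemma8F h8) c

end Maynard2016

end Literature.NumberTheory.Sieve
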